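import Literature.IUT.HodgeTheaters.TemperedCoveringsDihedralGroup
import Literature.IUT.HodgeTheaters.TemperedCoverings
import Mathlib.GroupTheory.Commensurable
import Mathlib.GroupTheory.Index
import Mathlib.Data.ZMod.QuotientGroup
import HarnessLib

/-!
# A NON-VACUOUS model of [IUTchI] Prop. 2.1 / Prop. 2.4 (i), (ii) at which Prop. 2.4 (iii) FAILS:
# the infinite dihedral group `D_∞ ↪ ℤ₂ ⋊ {±1}`

Mochizuki, *Inter-universal Teichmüller theory I: construction of Hodge theaters*, kurims manuscript
(May 2020), §2, Proposition 2.1 p. 45, Proposition 2.4 (i), (ii), (iii) p. 50 and its proof p. 50 l. 27 –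
p. 51 l. 19 [cite: Mochizuki2012, Prop 2.1 p.45; Prop 2.4 p.50] (D-0012 claim key; series status DISPUTED;
nothing of the series is asserted here).

MODEL FILE (abc-iut cell, block F fact-proving wave, seat abc-iut-f-193; FACT-LIST rows F-2599 `Prop24i`,
F-2600 `Prop24ii`, F-2601 `Prop24iii` of abc-iut-L5-t1's `TemperedCoverings.lean` — SCHEMATA over the §2
interface `StableCurveTemperedData`: their universal closures are refuted (`FactListL5TemperedSchemas`), the
genuine instances are the binders `h24i` / `h24ii` of `Summits/ABC/IUTFork/Conditional/Layer5OfS`, and the only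
positive model instances so far (`FreeModel.prop24i_model`, `FreeModel.prop24ii` at the free toy `F₂ ↪ F̂₂`)
hold VACUOUSLY — a discrete torsion-free group has no nontrivial compact subgroup).

Here is a datum at which the hypotheses of (i) and (ii) ARE met and the conclusion is a genuine arithmetic
constraint.  `Π^tp_X = Δ^tp_X = Π^tp_𝔾 := D_∞ = ℤ ⋊ {±1}` (discrete; the fundamental group of the graph of
groups `•_{C₂} — •_{C₂}`, i.e. of a semi-graph of anabelioids with two vertices `B(ℤ/2)` and a trivial
edge group — finite vertex groups, so NOT of PSC-type), `Π̂ := ℤ₂ ⋊ {±1}` (compact; the pro-2 completion of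
`D_∞`), `G_k := 1`, `Σ := {2} ⊆ Σ̂ := 𝔓𝔯𝔦𝔪𝔢𝔰`, `p := 3`, no cusps, no points (`DihedralModel.datum`).  Then
(`Dih`, `iota` and the lemmas below are elementary; the one number-theoretic input is the 2-ADIC PURITY of
`ℤ ⊂ ℤ₂`: `2b ∈ ℤ ⇒ b ∈ ℤ`, `exists_eq_intCast_of_two_mul`):
* `DihedralModel.prop24i`, `DihedralModel.prop24ii`, `DihedralModel.graph_prop21` — Prop. 2.4 (i), (ii) and
  Prop. 2.1 AS TYPED HOLD, NON-VACUOUSLY (`exists_hypotheses_prop24i`: the order-2 subgroup generated by a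
  reflection is compact, nontrivial and pro-`{2}`; `iota_not_surjective`: the conclusion excludes elements):
  a nontrivial compact `Λ ⊆ D_∞` contains a reflection `(a, −1)`, and `γ = (b, ε) ∈ ℤ₂ ⋊ {±1}` conjugates it
  to `(2b + εa, −1)`, which lies in `D_∞` iff `2b ∈ ℤ` iff `b ∈ ℤ` iff `γ ∈ D_∞`;
* `DihedralModel.not_prop24iii`, `not_graph_prop22` — Prop. 2.4 (iii) and Prop. 2.2 FAIL: the translation
  `γ₀ = (3⁻¹, 1) ∉ D_∞` centralises the translation subgroup `ℤ × 1` (index 2 on both sides), so it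
  COMMENSURATES `D_∞`: `D_∞` is not commensurably terminal in `ℤ₂ ⋊ {±1}` — yet it IS normally terminal
  (`graph_temperedNormallyTerminal`: Rmk. 2.2.2 AS TYPED holds, F-2591; normally ⇏ commensurably terminal);
* `DihedralModel.prop24i_prop24ii_not_prop24iii` — hence, over the typed interface, **(i) ∧ (ii) ⇏ (iii)**:
  print derives (iii) from (i) "by allowing `Λ` to range over the open subgroups of a pro-`Σ` Sylow subgroup
  of a decomposition group associated to an irreducible component" (p. 51 l. 14–17) — an INFINITE compact
  subgroup, which PSC-type vertex groups supply and `D_∞` (finite vertex groups) does not; this is exactly the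
  extra atom of the tree's derivations `prop24iii_of_prop24i'` (`∃` an infinite pro-`Σ` compact) and
  `prop24iii_ofSpecialFibre` (a cusp `x`, `I_x ≅ Ẑ(1)`), which therefore cannot be dropped.

HONEST LIMITS.  Consistency / independence evidence about the TYPED predicates only: the datum is not the
𝔛-datum of a hyperbolic curve (p. 46); `Π̂` is the pro-2 completion of `D_∞`, not its full profinite
completion `Ẑ ⋊ {±1}` (where the same commensurator phenomenon occurs); `G_k = 1`, so (ii) carries no
arithmetic content beyond (i).  No FACT-LIST closure is claimed proved; nothing here bears on [IUTchIII]
Cor. 3.12; instantiated ≠ endorsed; typed ≠ proved.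
-/

noncomputable section

namespace Literature.IUT.HodgeTheaters

open scoped Pointwise
open Literature.AnabelianGeometry.AbsoluteAnabelian (IsCommensurablyTerminal)
open Literature.AnabelianGeometry.SemiGraphs (IsProSigma)

namespace DihedralModel

/-! ### The datum -/

/-- `D_∞ = Dih ℤ` is discrete. [folklore] -/
instance instDiscreteTopologyDihInt : DiscreteTopology (Dih ℤ) := Dih.discreteTopology_of_discreteTopology

/-- `ℤ₂ ⋊ {±1} = Dih ℤ_[2]` is compact. [folklore] -/
instance instCompactSpaceDihPadic : CompactSpace (Dih ℤ_[2]) := Dih.compactSpace_of_compactSpace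

/-- **𝔾-level data of the dihedral model**: `Σ := {2} ⊆ Σ̂ := 𝔓𝔯𝔦𝔪𝔢𝔰`, `Π^tp_𝔾 := D_∞ ↪ Π̂_𝔾 := ℤ₂ ⋊ {±1}`
(`ι = iota`), `Π^tp_ℍ := Π^tp_𝔾`, `Π̂_ℍ := Π̂_𝔾`. ([IUTchI] §2 pp.44-45) [claim: Mochizuki2012, status: disputed] -/
@[reducible] def graph : TemperedGraphGroupData.{0} where
  Sigma := {2}
  SigmaHat := {q | q.Prime}
  sigma_subset := by
    intro q hq
    rw [Set.mem_singleton_iff] at hq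
    subst hq
    exact Nat.prime_two
  sigma_nonempty := ⟨2, rfl⟩
  sigmaHat_prime := fun _ h => h
  Tp := Dih ℤ
  Hat := Dih ℤ_[2]
  ι := iota
  ι_continuous := continuous_iota
  ι_injective := iota_injective
  TpH := ⊤
  HatH := ⊤
  tpH_le := le_top

/-- **The dihedral model datum**: curve level = graph level (`Π^tp_X = Δ^tp_X = D_∞`,
`Π̂_X = Δ̂_X = ℤ₂ ⋊ {±1}`, `G_k = 1`, residue characteristic `p = 3 ∉ Σ = {2}`), no cusps, no points.
([IUTchI] §2 pp.46-47) [claim: Mochizuki2012, status: disputed] -/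
@[reducible] def datum : StableCurveTemperedData.{0} where
  graph := graph
  p := 3
  p_notMem := by simp
  PiTp := Dih ℤ
  PiHat := Dih ℤ_[2]
  Gk := PUnit
  ιX := iota
  ιX_continuous := continuous_iota
  ιX_injective := iota_injective
  prTp := 1
  prHat := 1
  prTp_surjective := fun _ => ⟨1, Subsingleton.elim _ _⟩
  prHat_comp := MonoidHom.ext fun _ => rfl
  ρTp := (1 : Dih ℤ →* PUnit).ker.subtype
  ρHat := (1 : Dih ℤ_[2] →* PUnit).ker.subtype
  ρTp_surjective := fun x => ⟨⟨x, by simp⟩, rfl⟩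
  ρHat_surjective := fun x => ⟨⟨x, by simp⟩, rfl⟩
  ρ_comp := fun _ => rfl
  Cusp := Empty
  inertiaTp := fun x => nomatch x
  cuspMeetsH := fun _ => True
  Pt := Empty
  decompTp := fun x => nomatch x

/-! ### Non-vacuity of the hypotheses of Prop. 2.4 (i), (ii) at the datum -/

/-- The reflection `s = (0, −1) ∈ D_∞`. [folklore] -/
def refl : Dih ℤ := ⟨0, -1⟩

/-- `s ≠ 1`. (dihedral model of [IUTchI] §2 Prop 2.4 p.50) [claim: Mochizuki2012, status: disputed] -/
theorem refl_ne_one : refl ≠ 1 := by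
  intro h
  have := congrArg Dih.e h
  simp [refl] at this

/-- `s² = 1`. (dihedral model of [IUTchI] §2 Prop 2.4 p.50) [claim: Mochizuki2012, status: disputed] -/
theorem refl_mul_refl : refl * refl = 1 := by
  ext <;> simp [refl, Dih.one_def]

/-- `s` read in `Δ^tp_X = Ker(Π^tp_X → 1)`. ([IUTchI] §2 p.46) [claim: Mochizuki2012, status: disputed] -/
def reflDelta : datum.DeltaTp := ⟨refl, by simp⟩

/-- `s ∈ Δ^tp_X` has order `2`.
(dihedral model of [IUTchI] §2 Prop 2.4 p.50) [claim: Mochizuki2012, status: disputed] -/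
theorem orderOf_reflDelta : orderOf reflDelta = 2 := by
  refine orderOf_eq_prime ?_ ?_
  · exact Subtype.ext (by rw [pow_two]; exact refl_mul_refl)
  · intro h
    exact refl_ne_one (congrArg Subtype.val h)

/-- The subgroup `Λ₀ = ⟨s⟩ ≅ ℤ/2` of `Δ^tp_X` has two elements.
(dihedral model of [IUTchI] §2 Prop 2.4 p.50) [claim: Mochizuki2012, status: disputed] -/
theorem card_zpowers_reflDelta : Nat.card (Subgroup.zpowers reflDelta) = 2 := by
  rw [Nat.card_zpowers, orderOf_reflDelta]

/-- **Non-vacuity of the hypotheses of Prop. 2.4 (i) at the datum**: `Λ₀ = ⟨s⟩ ⊆ Δ^tp_X` is a nontrivial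
pro-`Σ` (`Σ = {2}`) compact subgroup. ([IUTchI] Prop 2.4(i) p.50) [claim: Mochizuki2012, status: disputed] -/
theorem exists_hypotheses_prop24i :
    ∃ Λ : Subgroup datum.DeltaTp, IsCompact (Λ : Set datum.DeltaTp) ∧ Λ ≠ ⊥ ∧ IsProSigma datum.graph.Sigma Λ := by
  refine ⟨Subgroup.zpowers reflDelta, ?_, ?_, ?_⟩
  · haveI : Finite (Subgroup.zpowers reflDelta) :=
      Nat.finite_of_card_ne_zero (by rw [card_zpowers_reflDelta]; decide)
    exact (Set.toFinite _).isCompact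
  · intro h
    have hmem : reflDelta ∈ Subgroup.zpowers reflDelta := Subgroup.mem_zpowers _
    rw [h, Subgroup.mem_bot] at hmem
    exact refl_ne_one (congrArg Subtype.val hmem)
  · refine ⟨fun U _ q hq hdvd => ?_⟩
    have h2 : Nat.card (Subgroup.zpowers reflDelta ⧸ U.toSubgroup) ∣ 2 := by
      rw [← card_zpowers_reflDelta]
      exact Subgroup.card_quotient_dvd_card _
    show q ∈ ({2} : Set ℕ)
    rw [Set.mem_singleton_iff]
    exact (Nat.prime_dvd_prime_iff_eq hq Nat.prime_two).mp (dvd_trans hdvd h2)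

/-- **Non-vacuity of the hypotheses of Prop. 2.4 (ii) at the datum**: `Σ̂ = 𝔓𝔯𝔦𝔪𝔢𝔰` holds, and
`⟨s⟩ ⊆ Π^tp_X` is a nontrivial compact subgroup with open image in `G_k`.
([IUTchI] Prop 2.4(ii) p.50) [claim: Mochizuki2012, status: disputed] -/
theorem exists_hypotheses_prop24ii :
    datum.graph.SigmaHat = {q | q.Prime} ∧
      ∃ Λ : Subgroup datum.PiTp, IsCompact (Λ : Set datum.PiTp) ∧ Λ ≠ ⊥ ∧
        IsOpen (Λ.map datum.prTp : Set datum.Gk) := by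
  refine ⟨rfl, Subgroup.zpowers refl, ?_, ?_, ?_⟩
  · have hcard : Nat.card (Subgroup.zpowers refl) = 2 := by
      rw [Nat.card_zpowers]
      exact orderOf_eq_prime (by rw [pow_two]; exact refl_mul_refl) refl_ne_one
    haveI : Finite (Subgroup.zpowers refl) := Nat.finite_of_card_ne_zero (by rw [hcard]; decide)
    exact (Set.toFinite _).isCompact
  · intro h
    have hmem : refl ∈ Subgroup.zpowers refl := Subgroup.mem_zpowers _
    rw [h, Subgroup.mem_bot] at hmem
    exact refl_ne_one hmem
  · have : ((Subgroup.zpowers refl).map datum.prTp : Set datum.Gk) = Set.univ :=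
      Set.eq_univ_of_forall fun u => by
        obtain rfl : u = 1 := Subsingleton.elim u 1
        exact Subgroup.one_mem _
    rw [this]
    exact isOpen_univ

/-- **The conclusion of Prop. 2.4 (i)/(ii) is a genuine constraint at the datum**: `ι : D_∞ → ℤ₂ ⋊ {±1}` is
not surjective (e.g. the translation by `3⁻¹ ∈ ℤ₂ ∖ ℤ` is missed — `γ₀_not_mem_range` below).
(dihedral model of [IUTchI] §2 Prop 2.4 p.50) [claim: Mochizuki2012, status: disputed] -/
theorem isUnit_three : IsUnit (3 : ℤ_[2]) := by
  rw [PadicInt.isUnit_iff]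
  have h3 : ((3 : ℤ) : ℤ_[2]) = 3 := by norm_cast
  rw [← h3]
  refine le_antisymm (PadicInt.norm_le_one _) (not_lt.mp fun hlt => ?_)
  have := (PadicInt.norm_int_lt_one_iff_dvd 3).mp hlt
  omega

/-- `b₀ := 3⁻¹ ∈ ℤ₂`. [folklore] -/
def b₀ : ℤ_[2] := ↑(isUnit_three.unit⁻¹)

/-- `3 · b₀ = 1`. (dihedral model of [IUTchI] §2 Prop 2.4 p.50) [claim: Mochizuki2012, status: disputed] -/
theorem three_mul_b₀ : 3 * b₀ = 1 := isUnit_three.mul_val_inv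

/-- `2 b₀ ∉ ℤ` (else `3 n = 2` in `ℤ`).
(dihedral model of [IUTchI] §2 Prop 2.4 p.50) [claim: Mochizuki2012, status: disputed] -/
theorem two_mul_b₀_ne_intCast (n : ℤ) : 2 * b₀ ≠ n := by
  intro h
  have h' : (2 : ℤ_[2]) = ((3 * n : ℤ) : ℤ_[2]) := by
    rw [Int.cast_mul, ← h, ← mul_assoc, Int.cast_ofNat]
    rw [show ((3 : ℤ_[2]) * 2) = 2 * 3 from mul_comm _ _, mul_assoc, three_mul_b₀, mul_one]
  have h'' : ((2 : ℤ) : ℤ_[2]) = ((3 * n : ℤ) : ℤ_[2]) := by rw [← h']; norm_cast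
  have := Int.cast_injective (α := ℤ_[2]) h''
  omega

/-- `b₀ ∉ ℤ` (else `3 n = 1` in `ℤ`).
(dihedral model of [IUTchI] §2 Prop 2.4 p.50) [claim: Mochizuki2012, status: disputed] -/
theorem b₀_ne_intCast (n : ℤ) : b₀ ≠ n := by
  intro h
  have h' : (1 : ℤ_[2]) = ((3 * n : ℤ) : ℤ_[2]) := by
    rw [Int.cast_mul, ← h, Int.cast_ofNat, three_mul_b₀]
  have h'' : ((1 : ℤ) : ℤ_[2]) = ((3 * n : ℤ) : ℤ_[2]) := by rw [← h']; norm_cast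
  have := Int.cast_injective (α := ℤ_[2]) h''
  omega

/-- The translation `γ₀ := (3⁻¹, 1) ∈ ℤ₂ ⋊ {±1}`. [folklore] -/
def γ₀ : Dih ℤ_[2] := ⟨b₀, 1⟩

/-- `γ₀ ∉ D_∞`. (dihedral model of [IUTchI] §2 Prop 2.4 p.50) [claim: Mochizuki2012, status: disputed] -/
theorem γ₀_not_mem_range : γ₀ ∉ iota.range := by
  rw [mem_range_iota_iff]
  rintro ⟨n, hn⟩
  exact b₀_ne_intCast n hn

/-- `ι : D_∞ → ℤ₂ ⋊ {±1}` is not surjective.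
(dihedral model of [IUTchI] §2 Prop 2.4 p.50) [claim: Mochizuki2012, status: disputed] -/
theorem iota_not_surjective : ¬ Function.Surjective iota := fun h => by
  obtain ⟨x, hx⟩ := h γ₀
  exact γ₀_not_mem_range ⟨x, hx⟩

/-! ### Prop. 2.4 (i), (ii) and Prop. 2.1 HOLD at the datum -/

/-- **[IUTchI] Prop. 2.4 (i) AS TYPED HOLDS at the dihedral datum, non-vacuously**: a nontrivial compact
`Λ ⊆ Δ^tp_X = D_∞` is finite, hence contains a reflection `(a, −1)`; `γ = (b, ε)` conjugates it to
`(2b + εa, −1)`, which lies in `Δ^tp_X` only if `2b ∈ ℤ`, i.e. (2-adic purity) `b ∈ ℤ`, i.e. `γ ∈ Π^tp_X`.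
(FACT-LIST F-2599, instance form; cf. `exists_hypotheses_prop24i`, `iota_not_surjective`.)
([IUTchI] Prop 2.4(i) p.50) [claim: Mochizuki2012, status: disputed] -/
theorem prop24i : datum.Prop24i := by
  refine ⟨fun Λ hΛc hΛne _ γ hγ => ?_⟩
  have hfin : (Λ : Set datum.DeltaTp).Finite := hΛc.finite_of_discrete
  have hfin' : ((Λ.map datum.DeltaTp.subtype : Subgroup (Dih ℤ)) : Set (Dih ℤ)).Finite := by
    rw [Subgroup.coe_map]
    exact hfin.image _
  have hne' : (Λ.map datum.DeltaTp.subtype : Subgroup (Dih ℤ)) ≠ ⊥ := by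
    rwa [Ne, Subgroup.map_eq_bot_iff_of_injective Λ (Subgroup.subtype_injective _)]
  obtain ⟨x, hx, hxe⟩ := exists_reflection_of_finite hfin' hne'
  obtain ⟨l, hl, rfl⟩ := Subgroup.mem_map.mp hx
  exact mem_range_of_conj_reflection_mem γ (l : Dih ℤ) hxe (Subgroup.map_le_range _ _ (hγ l hl))

/-- **[IUTchI] Prop. 2.4 (ii) AS TYPED HOLDS at the dihedral datum, non-vacuously** (`Σ̂ = 𝔓𝔯𝔦𝔪𝔢𝔰` holds;
same mechanism: a nontrivial compact `Λ ⊆ Π^tp_X` contains a reflection).  (FACT-LIST F-2600, instance form;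
cf. `exists_hypotheses_prop24ii`.) ([IUTchI] Prop 2.4(ii) p.50) [claim: Mochizuki2012, status: disputed] -/
theorem prop24ii : datum.Prop24ii := by
  refine ⟨fun _ Λ hΛc hΛne _ γ hγ => ?_⟩
  have hfin : (Λ : Set (Dih ℤ)).Finite := hΛc.finite_of_discrete
  obtain ⟨x, hx, hxe⟩ := exists_reflection_of_finite hfin hΛne
  exact mem_range_of_conj_reflection_mem γ x hxe (hγ x hx)

/-- **[IUTchI] Prop. 2.1 AS TYPED HOLDS at the dihedral 𝔾-data, non-vacuously** (FACT-LIST F-2589, instance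
form: `D_∞ = Π^tp_𝔾` of the graph of groups `•_{C₂} — •_{C₂}`; the existing model instance
`FreeModel.graph_prop21_vacuous` is vacuous). ([IUTchI] Prop 2.1 p.45) [claim: Mochizuki2012, status: disputed] -/
theorem graph_prop21 : graph.ProfiniteConjugatesOfCompactSubgroups := by
  refine ⟨fun Λ hΛc hΛne γ hγ => ?_⟩
  have hfin : (Λ : Set (Dih ℤ)).Finite := hΛc.finite_of_discrete
  obtain ⟨x, hx, hxe⟩ := exists_reflection_of_finite hfin hΛne
  exact mem_range_of_conj_reflection_mem γ x hxe (hγ x hx)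

/-! ### Prop. 2.4 (iii) and Prop. 2.2 FAIL at the datum: `D_∞` is commensurated by `γ₀ ∉ D_∞` -/

/-- A relative-index bound: if every element of `B` in the kernel of a homomorphism `f` to a FINITE group
lies in `A`, then `A ∩ B` has finite index in `B` (`A.relIndex B ≠ 0`).
(dihedral model of [IUTchI] §2 Prop 2.4 p.50) [claim: Mochizuki2012, status: disputed] -/
theorem relIndex_ne_zero_of_ker_le {G M : Type*} [Group G] [Group M] [Finite M] (f : G →* M)
    {A B : Subgroup G} (h : ∀ b ∈ B, f b = 1 → b ∈ A) : A.relIndex B ≠ 0 := by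
  have hle : (f.comp B.subtype).ker ≤ A.subgroupOf B := by
    intro b hb
    rw [MonoidHom.mem_ker, MonoidHom.comp_apply] at hb
    exact Subgroup.mem_subgroupOf.mpr (h b b.2 hb)
  have hdvd : (A.subgroupOf B).index ∣ (f.comp B.subtype).ker.index := Subgroup.index_dvd_of_le hle
  rw [Subgroup.index_ker] at hdvd
  have hne : Nat.card (f.comp B.subtype).range ≠ 0 := Nat.card_pos.ne'
  intro h0
  rw [Subgroup.relIndex] at h0
  rw [h0, zero_dvd_iff] at hdvd
  exact hne hdvd

/-- Membership in the conjugate `γ₀ · D_∞ · γ₀⁻¹`.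
(dihedral model of [IUTchI] §2 Prop 2.4 p.50) [claim: Mochizuki2012, status: disputed] -/
theorem mem_conj_range_iff (x : Dih ℤ_[2]) :
    x ∈ ConjAct.toConjAct γ₀ • iota.range ↔ γ₀⁻¹ * x * γ₀ ∈ iota.range := by
  rw [Subgroup.mem_pointwise_smul_iff_inv_smul_mem, ← map_inv, ConjAct.smul_def,
    ConjAct.ofConjAct_toConjAct, inv_inv]

/-- `γ₀` centralises translations: `γ₀ (a, 1) γ₀⁻¹ = (a, 1)` and `γ₀⁻¹ (a, 1) γ₀ = (a, 1)`.
(dihedral model of [IUTchI] §2 Prop 2.4 p.50) [claim: Mochizuki2012, status: disputed] -/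
theorem conj_γ₀_of_e_eq_one (x : Dih ℤ_[2]) (hx : x.e = 1) :
    γ₀ * x * γ₀⁻¹ = x ∧ γ₀⁻¹ * x * γ₀ = x := by
  constructor
  · rw [Dih.conj_translation γ₀ x hx]
    exact Dih.ext (by simp [γ₀]) hx.symm
  · have h := Dih.conj_translation γ₀⁻¹ x hx
    rw [inv_inv] at h
    rw [h]
    exact Dih.ext (by simp [γ₀]) hx.symm

/-- **`γ₀` commensurates `D_∞`**: `γ₀ D_∞ γ₀⁻¹ ∩ D_∞` contains the translation subgroup `ℤ × 1`, of index
`≤ 2` on both sides (detected by the sign homomorphism to the finite group `{±1}`).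
(dihedral model of [IUTchI] §2 Prop 2.4 p.50) [claim: Mochizuki2012, status: disputed] -/
theorem γ₀_mem_commensurator : γ₀ ∈ Subgroup.Commensurable.commensurator iota.range := by
  rw [Subgroup.Commensurable.commensurator_mem_iff]
  constructor
  · -- `relIndex (γ₀ • D_∞) D_∞ ≠ 0`: translations of `D_∞` lie in `γ₀ • D_∞`
    refine relIndex_ne_zero_of_ker_le Dih.sgn fun b hb hb1 => ?_
    rw [mem_conj_range_iff, (conj_γ₀_of_e_eq_one b hb1).2]
    exact hb
  · -- `relIndex D_∞ (γ₀ • D_∞) ≠ 0`: translations of `γ₀ • D_∞` lie in `D_∞`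
    refine relIndex_ne_zero_of_ker_le Dih.sgn fun b hb hb1 => ?_
    rw [mem_conj_range_iff, (conj_γ₀_of_e_eq_one b hb1).2] at hb
    exact hb

/-- **`Π^tp_X = D_∞` is NOT commensurably terminal in `Π̂_X = ℤ₂ ⋊ {±1}`.**
([IUTchI] Prop 2.4(iii) p.50) [claim: Mochizuki2012, status: disputed] -/
theorem not_isCommensurablyTerminal_range : ¬ IsCommensurablyTerminal iota.range := fun h =>
  γ₀_not_mem_range (h.commensurator_eq ▸ γ₀_mem_commensurator)

/-- **[IUTchI] Prop. 2.4 (iii) AS TYPED FAILS at the dihedral datum** (its `Π`-clause; the `Δ`-clause is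
the same subgroup). (FACT-LIST F-2601, counter-instance.) ([IUTchI] Prop 2.4(iii) p.50) [claim: Mochizuki2012, status: disputed] -/
theorem not_prop24iii : ¬ datum.Prop24iii := fun h => not_isCommensurablyTerminal_range h.pi

/-- **[IUTchI] Prop. 2.2 AS TYPED FAILS at the dihedral 𝔾-data** (its "in particular" clause `tp_in_hat`:
`Π^tp_𝔾 = D_∞` is not commensurably terminal in `Π̂_𝔾`) — as print predicts: Prop. 2.2 is stated for
`𝔾` of PSC-type (infinite verticial groups), which `•_{C₂} — •_{C₂}` is not. (FACT-LIST F-2590,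
counter-instance.) ([IUTchI] Prop 2.2 p.45) [claim: Mochizuki2012, status: disputed] -/
theorem not_graph_prop22 : ¬ graph.CommensuratorsOfDecompositionSubgroups := fun h =>
  not_isCommensurablyTerminal_range h.tp_in_hat

/-- **[IUTchI] Rmk. 2.2.2 AS TYPED HOLDS at the dihedral 𝔾-data** (`Σ̂ = 𝔓𝔯𝔦𝔪𝔢𝔰`): `Π^tp_𝔾 = D_∞` IS normally
terminal in `Π̂_𝔾 = ℤ₂ ⋊ {±1}` (a normalising `γ` conjugates the reflection `s` into `D_∞`, hence `γ ∈ D_∞`)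
although it is NOT commensurably terminal (`not_graph_prop22`): at this datum the converse of [AbsAnab]
Rmk. 0.1.2 fails and Rmk. 2.2.2 does not come from Prop. 2.2.  (FACT-LIST F-2591, instance form, non-vacuous.)
([IUTchI] Rmk 2.2.2 p.46) [claim: Mochizuki2012, status: disputed] -/
theorem graph_temperedNormallyTerminal : graph.TemperedNormallyTerminal := by
  refine ⟨fun _ => ⟨le_antisymm (fun γ hγ => ?_) Subgroup.le_normalizer⟩⟩
  have h := (Subgroup.mem_normalizer_iff.mp hγ (iota refl)).mp ⟨refl, rfl⟩
  exact mem_range_of_conj_reflection_mem γ refl rfl h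

/-! ### Independence of (iii) from (i) ∧ (ii) over the typed interface -/

/-- **(i) ∧ (ii) ⇏ (iii) for the typed [IUTchI] Prop. 2.4**: there is a §2 datum with `Σ̂ = 𝔓𝔯𝔦𝔪𝔢𝔰`
carrying a nontrivial pro-`Σ` compact subgroup of `Δ^tp_X` (so (i), (ii) are not vacuous) at which
Prop. 2.4 (i) and (ii) AS TYPED hold and Prop. 2.4 (iii) AS TYPED fails.  Print's derivation of (iii) from
(i) uses an INFINITE compact subgroup (open subgroups of a pro-`Σ` Sylow subgroup of a verticial
decomposition group, p. 51 l. 14–17) — the extra atom of the tree's `prop24iii_of_prop24i'` /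
`prop24iii_ofSpecialFibre` (a cusp), which therefore cannot be dropped.
([IUTchI] Prop 2.4 pp.50-51) [claim: Mochizuki2012, status: disputed] -/
theorem prop24i_prop24ii_not_prop24iii :
    ∃ D : StableCurveTemperedData.{0}, D.graph.SigmaHat = {q | q.Prime} ∧
      (∃ Λ : Subgroup D.DeltaTp, IsCompact (Λ : Set D.DeltaTp) ∧ Λ ≠ ⊥ ∧ IsProSigma D.graph.Sigma Λ) ∧
      D.Prop24i ∧ D.Prop24ii ∧ ¬ D.Prop24iii :=
  ⟨datum, rfl, exists_hypotheses_prop24i, prop24i, prop24ii, not_prop24iii⟩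

/-- **Prop. 2.1 ∧ Rmk. 2.2.2 ⇏ Prop. 2.2 for the typed 𝔾-level predicates** (same datum, graph level):
FACT-LIST F-2589 and F-2591 hold non-vacuously and F-2590 fails at `DihedralModel.graph`.
([IUTchI] Prop 2.1/2.2 p.45) [claim: Mochizuki2012, status: disputed] -/
theorem graph_prop21_not_prop22 :
    ∃ G : TemperedGraphGroupData.{0}, G.SigmaHat = {q | q.Prime} ∧
      (∃ Λ : Subgroup G.Tp, IsCompact (Λ : Set G.Tp) ∧ Λ ≠ ⊥) ∧
      G.ProfiniteConjugatesOfCompactSubgroups ∧ G.TemperedNormallyTerminal ∧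
      ¬ G.CommensuratorsOfDecompositionSubgroups := by
  obtain ⟨_, Λ, hc, hne, _⟩ := exists_hypotheses_prop24ii
  exact ⟨graph, rfl, ⟨Λ, hc, hne⟩, graph_prop21, graph_temperedNormallyTerminal, not_graph_prop22⟩

end DihedralModel

end Literature.IUT.HodgeTheaters

end
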